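import Literature.NumberTheory.Automorphic.NonsplitPlaceHaarBallRatios        -- ★ L-β0: `isUnit_toLocalRing_uniformizer`, `conjLocal_toLocalRing_uniformizer`, `valued_toLocalRing_uniformizer_apply`
import Literature.NumberTheory.Automorphic.UnitaryGroupRegularTwistModulus     -- ★ `exists_conjLocal_skew_unit` (a `c̄ ⊗ 1`-skew unit of `∏_{w ∣ v} L_w`)
import HarnessLib

/-!
# K2 ∕ E3 «EllipticInputs», unit U4 «Keys» — socket :155 (depth 0, Branch B), Z3-c frame letter «`δ₀`»: A SKEW UNIT OF VALUATION ONE EXISTS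
# at every finite place `v` of `L⁺` UNRAMIFIED in the CM field `L`: `∃ δ₀ ∈ (L ⊗ L⁺_v)ˣ, σδ₀ = −δ₀, |(δ₀)_w|_w = 1`

Cell hodgecm-mathlib (D-0151), FLOOR 0, Track B «K2-LIT», engine E3, crux item H413 = stmt-HodgeConjecture-24833 (route `HCCMUnconditional`, no route verbs); target BY NAME the
OPEN socket `…U4Keys.sig_K2E3KeysThmTwoContractingRamifiedCharOneDepthZeroNormTrivial` (:155; Keys §7 Thm. (2), ramified `χ₁` of depth 0 with `χ₁ ∘ N = 1` on units = BRANCH B).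
The Z3-c SHARED FRAME v1 (`K2/K2E3-p03/g9/Z3c-frame.v1.txt`) of the cell «U4-RAM» carries the letters `(δ₀ : (LocalRing L v)ˣ) (hδσ : σ δ₀ = −δ₀) (hδv : |(δ₀)_w|_w = 1)` — the skew unit
fixing the sign `ε₀ = χ₁(δ₀)` of every shell identity ((II)-a, (II)-b1, (II)-b2 «Φ₁», (II)-b3, ★ `K2E3BranchBSkewUnitSign`, ★ `K2E3BranchBSkewLineIntegrals`, ★ `K2E3BranchBShellZeroFibres`).
This file DISCHARGES that letter once and for all, so the frame-free closing wrapper of :155 (`K2E3KeysThmTwoDepthZeroBranchBInertLeaf`) and the final payer can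
instantiate `δ₀` by `obtain`.  Typed by the S1 hand R90-C10-p04 (g0) (dealt by default to the (II)-b3 support line by the K2 chair, 2026-09-04T21:51Z/21:53Z).
`--supports stmt-HodgeConjecture-24833 --as helper`; THEOREMS ONLY (no `def`, no `instance`, no notation, no named-fact hypothesis, no `sorry`).  NOT THE PAYER.

MATHEMATICS.  `R := L ⊗ L⁺_v = ∏_{w′ ∣ v} L_{w′}`, `σ := c̄ ⊗ 1`.  ★ `exists_conjLocal_skew_unit` gives a unit `δ` of `R` with `σδ = −δ` (namely `(e − c̄e) ⊗ 1`); its `w`-component is a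
non-zero element of `L_w`, so `|δ_w|_w = exp(m)` for some `m ∈ ℤ`.  The uniformiser unit `ϖ̂ = ι_v(ϖ_v)` is `σ`-FIXED (★ `conjLocal_toLocalRing_uniformizer`) and, `v` being unramified
in `L`, `|ϖ̂_w|_w = exp(−1)` (★ `valued_toLocalRing_uniformizer_apply`); hence `δ₀ := δ·ϖ̂^m` (`m ≥ 0`) resp. `δ·(ϖ̂⁻¹)^{−m}` (`m < 0`) is skew of valuation one.  No parity
hypothesis: the same letter serves the dyadic inert places.
* §1 **`valued_coe_units_inv_apply`** — `|(u⁻¹)_w| = |u_w|⁻¹` for a unit `u` of `R`; **`valued_coe_units_apply_ne_zero`**.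
* §2 **`exists_skew_unit_valued_eq_one`** — THE LETTER: `∃ δ₀ : Rˣ, σ δ₀ = −δ₀ ∧ |(δ₀)_w|_w = 1`.

HONEST LABEL: HC_CM is proved only modulo the 7 printed citations (2 remaining named inputs: hLiu418 = stmt-HodgeConjecture-24832, h413 = stmt-HodgeConjecture-24833)
until rung 0 closes; count-neutral — this file does NOT pay the socket; no printed citation is discharged.

## References
* [Rogawski1990] J. Rogawski, *Automorphic representations of unitary groups in three variables*, Ann. of Math. Stud. 123 (1990), §1.10 p. 9 (`E_v = E ⊗ F_v`, the involution).
* [NeukirchANT1999] J. Neukirch, *Algebraic Number Theory* (1999), Ch. II §6 (discrete valuations; unramified extensions keep the uniformiser).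
* [Keys1984] D. Keys, *Principal series representations of special unitary groups over local fields*, Compositio Math. 51 (1984), §7 Thm. (2) p. 126.
-/

set_option autoImplicit false
-- the mandated namespace has the single-problem summit's repeated segment (`HodgeConjecture.HodgeConjecture`)
set_option linter.dupNamespace false

noncomputable section

open NumberField IsDedekindDomain
open Literature.NumberTheory Literature.NumberTheory.Automorphic Literature.NumberTheory.Automorphic.UnitaryGroup

namespace Summit.HodgeConjecture.HodgeConjecture.Cruxes.H413.K2E3BranchBSkewUnitExists

variable (L : Type) [Field L] [NumberField L] [IsCMField L] (v : HeightOneSpectrum (𝓞 ↥(maximalRealSubfield L)))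
  (w : PlacesOver L v)

/-! ## §1 Valuations of unit components -/

omit [IsCMField L] in
/-- For a unit `u` of `R = ∏_{w′} L_{w′}`: `|(u⁻¹)_w|_w · |u_w|_w = 1`. [cite: NeukirchANT1999, Ch. II §6] -/
theorem valued_coe_units_inv_apply_mul (u : (LocalRing L v)ˣ) :
    Valued.v (((u⁻¹ : (LocalRing L v)ˣ) : LocalRing L v) w) * Valued.v ((u : LocalRing L v) w) = 1 := by
  rw [← map_mul, ← Pi.mul_apply, Units.inv_mul, Pi.one_apply, map_one]

omit [IsCMField L] in
/-- For a unit `u` of `R = ∏_{w′} L_{w′}`: `|u_w|_w ≠ 0` (the component is a unit of the field `L_w`). [cite: NeukirchANT1999, Ch. II §6] -/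
theorem valued_coe_units_apply_ne_zero (u : (LocalRing L v)ˣ) : Valued.v ((u : LocalRing L v) w) ≠ 0 := by
  intro h0
  have h := valued_coe_units_inv_apply_mul L v w u
  rw [h0, mul_zero] at h
  exact zero_ne_one h

omit [IsCMField L] in
/-- For a unit `u` of `R = ∏_{w′} L_{w′}`: `|(u⁻¹)_w|_w = |u_w|_w⁻¹`. [cite: NeukirchANT1999, Ch. II §6] -/
theorem valued_coe_units_inv_apply (u : (LocalRing L v)ˣ) :
    Valued.v (((u⁻¹ : (LocalRing L v)ˣ) : LocalRing L v) w) = (Valued.v ((u : LocalRing L v) w))⁻¹ :=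
  eq_inv_of_mul_eq_one_left (valued_coe_units_inv_apply_mul L v w u)

omit [IsCMField L] in
/-- For a unit `u` of `R` and `n : ℕ`: `|(u ^ n)_w|_w = |u_w|_w ^ n`. [cite: NeukirchANT1999, Ch. II §6] -/
theorem valued_coe_units_pow_apply (u : (LocalRing L v)ˣ) (n : ℕ) :
    Valued.v (((u ^ n : (LocalRing L v)ˣ) : LocalRing L v) w) = (Valued.v ((u : LocalRing L v) w)) ^ n := by
  rw [Units.val_pow_eq_pow_val, Pi.pow_apply, map_pow]

/-! ## §2 The letter `δ₀`: a skew unit of valuation one -/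

/-- `σ` commutes with powers of units read in `R`: `σ((u ^ n : Rˣ) : R) = ((Units.map σ u) ^ n : Rˣ)` — bookkeeping. [cite: Rogawski1990, §1.10 p. 9] -/
theorem conjLocal_coe_units_pow (u : (LocalRing L v)ˣ) (n : ℕ) :
    conjLocal L (IsCMField.complexConj L) v (((u ^ n : (LocalRing L v)ˣ) : LocalRing L v)) =
      (conjLocal L (IsCMField.complexConj L) v (u : LocalRing L v)) ^ n := by
  rw [Units.val_pow_eq_pow_val, map_pow]

/-- **THE FRAME LETTER `δ₀`.**  At a finite place `v` of `L⁺` unramified in `L` and any place `w ∣ v`: there is a unit `δ₀` of `R = L ⊗ L⁺_v` with `σ δ₀ = −δ₀` and `|(δ₀)_w|_w = 1`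
(`δ₀ = δ·ϖ̂^{±m}` for ★ `exists_conjLocal_skew_unit`'s `δ` with `|δ_w| = exp(m)`, `ϖ̂ = ι_v ϖ_v` the `σ`-fixed uniformiser unit of valuation `exp(−1)`).  This is the binder triple
`(δ₀) (hδσ) (hδv)` of the Z3-c frame v1 (★ `K2E3BranchBSkewUnitSign`, ★ `K2E3BranchBSkewLineIntegrals`, ★ `K2E3BranchBSkewLineCharacterIntegral`, ★ `K2E3BranchBShellZeroFibres`).
[cite: Rogawski1990, §1.10 p. 9] [cite: NeukirchANT1999, Ch. II §6] [cite: Keys1984, §7 Theorem (2) p. 126] -/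
theorem exists_skew_unit_valued_eq_one (hunr : Algebra.IsUnramifiedIn (𝓞 L) v.asIdeal) :
    ∃ δ₀ : (LocalRing L v)ˣ, conjLocal L (IsCMField.complexConj L) v (δ₀ : LocalRing L v) = -(δ₀ : LocalRing L v) ∧
      Valued.v ((δ₀ : LocalRing L v) w) = 1 := by
  obtain ⟨δ, hδ⟩ := exists_conjLocal_skew_unit L v
  set ϖ : (LocalRing L v)ˣ := (isUnit_toLocalRing_uniformizer L v).unit with hϖdef
  have hϖw : Valued.v ((ϖ : LocalRing L v) w) = WithZero.exp (-1 : ℤ) := valued_toLocalRing_uniformizer_apply L v w hunr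
  have hϖσ : conjLocal L (IsCMField.complexConj L) v (ϖ : LocalRing L v) = ϖ := conjLocal_toLocalRing_uniformizer L v
  -- `σ` fixes `ϖ⁻¹` as well
  have hϖiσ : conjLocal L (IsCMField.complexConj L) v ((ϖ⁻¹ : (LocalRing L v)ˣ) : LocalRing L v) = ((ϖ⁻¹ : (LocalRing L v)ˣ) : LocalRing L v) := by
    have hmul : conjLocal L (IsCMField.complexConj L) v ((ϖ⁻¹ : (LocalRing L v)ˣ) : LocalRing L v) * (ϖ : LocalRing L v) = 1 := by
      have h1 : conjLocal L (IsCMField.complexConj L) v (((ϖ⁻¹ : (LocalRing L v)ˣ) : LocalRing L v) * (ϖ : LocalRing L v)) = 1 := by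
        rw [Units.inv_mul, map_one]
      rw [map_mul, hϖσ] at h1
      exact h1
    exact (Units.inv_eq_of_mul_eq_one_left hmul).symm
  have hϖiw : Valued.v (((ϖ⁻¹ : (LocalRing L v)ˣ) : LocalRing L v) w) = WithZero.exp (1 : ℤ) := by
    rw [valued_coe_units_inv_apply, hϖw, ← WithZero.exp_neg, neg_neg]
  -- the valuation of `δ_w` is `exp m`
  have hδ0 : Valued.v ((δ : LocalRing L v) w) ≠ 0 := valued_coe_units_apply_ne_zero L v w δ
  obtain ⟨n, hn⟩ := Int.eq_nat_or_neg (WithZero.log (Valued.v ((δ : LocalRing L v) w)))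
  have hδw : Valued.v ((δ : LocalRing L v) w) = WithZero.exp (WithZero.log (Valued.v ((δ : LocalRing L v) w))) := (WithZero.exp_log hδ0).symm
  rcases hn with hn | hn
  · -- `|δ_w| = exp n`, `n ≥ 0`: take `δ₀ = δ · ϖ̂ ^ n`
    refine ⟨δ * ϖ ^ n, ?_, ?_⟩
    · rw [Units.val_mul, map_mul, conjLocal_coe_units_pow, hδ, hϖσ, ← Units.val_pow_eq_pow_val, neg_mul]
    · rw [Units.val_mul, Pi.mul_apply, map_mul, valued_coe_units_pow_apply, hϖw, hδw, hn, ← WithZero.exp_nsmul, ← WithZero.exp_add,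
        smul_neg, nsmul_eq_mul, mul_one, add_neg_cancel, WithZero.exp_zero]
  · -- `|δ_w| = exp (−n)`: take `δ₀ = δ · (ϖ̂⁻¹) ^ n`
    refine ⟨δ * ϖ⁻¹ ^ n, ?_, ?_⟩
    · rw [Units.val_mul, map_mul, conjLocal_coe_units_pow, hδ, hϖiσ, ← Units.val_pow_eq_pow_val, neg_mul]
    · rw [Units.val_mul, Pi.mul_apply, map_mul, valued_coe_units_pow_apply, hϖiw, hδw, hn, ← WithZero.exp_nsmul, ← WithZero.exp_add,
        nsmul_eq_mul, mul_one, neg_add_cancel, WithZero.exp_zero]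

end Summit.HodgeConjecture.HodgeConjecture.Cruxes.H413.K2E3BranchBSkewUnitExists

end
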